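import Summits.FinalStateConjecture.FinalStateConjecture.Theorems.ZeroEnergyKerrOrBombStationaryLimitReductionRecutCoveringJunctionCore
import Literature.Geometry.Lorentzian.CausalFutureProofs
import Literature.Geometry.Lorentzian.KerrSchild
import HarnessLib

/-!
# Route ZeroEnergyKerrOrBomb · crux `FinalStateFromKerrOrBomb` (stmt-FinalStateConjecture-17839), line
# `SketchIdeator1` — stub `stub_recutJunctionCoreOriented`: the core reduces to the PAST-BOUNDARY PROPERTY of
# the recut certified late region seen from the flat late region (ingredient (γ); the exact residual)

Helper file (`--supports stmt-FinalStateConjecture-17839`; registered helper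
`recutJunctionCoreOriented_of_pastBoundary`) of the lead's wave-3 stub worker (2026-08-17), companion of
`…FinalStateFromKerrOrBombRecutJunctionHoleTube.lean` (ingredient (α), proposed the same day).

The oriented junction core asks, for late `τ₁` and the transported radii `R'ᵢ τ = Rᵢ (cᵢ τ − s) − W`, that
`(J⁻(docHoleSlabs d R τ₁) ∪ docHoleTubes d R τ₁) \ Ω(τ₁) ⊆ J⁻(Σ(τ₁))`, `Ω(τ₁) = recutCertifiedLate … R' τ₁`,
`Σ(τ₁) = recutCertifiedSlab … R' τ₁`. By horizon normalisation the whole left-hand side lies in `J⁻` of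
arbitrarily late FLAT slabs (wave 1, `docHole_causalPast_flatSlab`, p136881 — private copy in §1), hence in
`J⁻(Ψ₀(flat late region after τ₁))` (§2, `docHole_subset_causalPast_flatLate`). Consequently (§3) the core is
implied by — and, on its left-hand side, IS — the past-boundary property of `Ω(τ₁)` seen from its flat piece:

  (PB)  `J⁻(Ψ₀({x⁰ > τ₁})) \ recutCertifiedLate d M a Θ R' τ₁ ⊆ J⁻(recutCertifiedSlab d M a Θ R' τ₁)` for late `τ₁`,

i.e. a future causal curve from a point outside `Ω(τ₁)` to a flat point of flat time `> τ₁` passes through the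
flat slab `{x⁰ = τ₁}` or a recut Kerr–Schild slab `{t*ᵢ = τ₁, rᵢ ≤ R'ᵢ τ₁}`, or starts at a point flowing into one.
`recutJunctionCoreOriented_of_pastBoundary` is the registered text of the oriented core with (PB) inserted after the
orientation clauses (thresholds `s₁ = 0`, `τJ = max τP τ₀`). What (PB) still contains (worker report): the
radiation-zone points of flat time `≤ τ₁` below late flat points (flat time lines need not stay in the flat
domain), the closed ergoregion and the horizon strip of the hole tubes (entry-point argument along the
normalisation curve), and the closure of the flat late image — the chart transition maps are not part of the
structure, so none of these is formal today. The far hole-tube points of Kerr–Schild time `≤ τ₁` and radius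
`≤ R'ᵢ τ₁` are covered WITHOUT (PB) by the companion file (ingredient (α)).

Elementary; no named fact, nothing restated. References: Dafermos–Luk arXiv:1710.01722, Conjecture 1 (b)–(c);
O'Neill 1983, Ch. 14, pp. 402–403.
-/

set_option linter.dupNamespace false

noncomputable section

open scoped Manifold ContDiff Topology ENNReal
open Set Filter Function Literature.Geometry.Lorentzian

namespace Summit.FinalStateConjecture.FinalStateConjecture.Theorems.SymplecticDualOfTheBomb

open Summit.FinalStateConjecture.FinalStateConjecture.Theorems.OneLockedExplosion

/-! ## §1 Private copies of the wave-1 lemmas (`…FinalStateFromKerrOrBombRecutJunctionCore.lean`, unbuilt today) -/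

section Copies

variable {𝓢 : Spacetime.{0} 4} {O : Set 𝓢.carrier} {k : ℕ}

/-- Private copy of `docHoleSlabs_subset_iUnion` (…RecutJunctionCore, unbuilt today): the old d.o.c. hole slabs at
`τ₁ > τ₀` consist of late d.o.c.-part chart points. [folklore] -/
private theorem docHoleSlabs_subset_iUnion_w3 (d : StationaryFinalStateDecomposition 𝓢 O k) (R : Fin d.N → ℝ → ℝ)
    {τ₁ : ℝ} (hτ : d.toOver.τ₀ < τ₁) :
    docHoleSlabs d R τ₁ ⊆ ⋃ i, d.toOver.chart i '' ((d.background i).lateRegion d.toOver.τ₀ ∩ docPart d i) :=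
  iUnion_mono fun _ ↦ image_mono fun _ hx ↦ ⟨lt_of_lt_of_eq hτ hx.1.1.symm, hx.2⟩

/-- Private copy of `docHoleTubes_subset_iUnion` (…RecutJunctionCore, unbuilt today): the old d.o.c.-certified hole
tubes after `τ₁ ≥ τ₀` consist of late d.o.c.-part chart points. [folklore] -/
private theorem docHoleTubes_subset_iUnion_w3 (d : StationaryFinalStateDecomposition 𝓢 O k) (R : Fin d.N → ℝ → ℝ)
    {τ₁ : ℝ} (hτ : d.toOver.τ₀ ≤ τ₁) :
    docHoleTubes d R τ₁ ⊆ ⋃ i, d.toOver.chart i '' ((d.background i).lateRegion d.toOver.τ₀ ∩ docPart d i) :=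
  iUnion_mono fun _ ↦ image_mono fun _ hx ↦ ⟨lt_of_le_of_lt hτ hx.1.1, hx.2⟩

end Copies

section Causal

variable {E : Type*} [NormedAddCommGroup E] [NormedSpace ℝ E] {H : Type*} [TopologicalSpace H]
  {I : ModelWithCorners ℝ E H} {n : ℕ∞ω} {M : Type*} [TopologicalSpace M] [ChartedSpace H M]
  [IsManifold I ∞ M] {g : LorentzianMetric I n M} {τ : TimeOrientation g}

/-- Private copy of `exists_mem_causalPast_singleton_of_mem_causalPast` (…RecutJunctionCore, unbuilt today): a
point of `J⁻(S)` is in `J⁻` of a single point of `S`. O'Neill 1983, Ch. 14, p. 403. [folklore] -/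
private theorem exists_mem_causalPast_singleton_w3 {S : Set M} {p : M} (hp : p ∈ g.causalPast τ S) :
    ∃ q ∈ S, p ∈ g.causalPast τ ({q} : Set M) := by
  rcases hp with hp | ⟨q, hq, h⟩
  · exact ⟨p, hp, LorentzianMetric.subset_causalPast g τ _ (mem_singleton p)⟩
  · exact ⟨q, hq, Or.inr ⟨q, mem_singleton q, h⟩⟩

/-- Private copy of `causalPast_subset_causalPast_of_subset` (…RecutJunctionCore, unbuilt today): transitivity of
`J⁻` for sets, `T ⊆ J⁻(S) ⟹ J⁻(T) ⊆ J⁻(S)` (`C²` metric, no boundary). O'Neill 1983, Ch. 14, p. 402. [folklore] -/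
private theorem causalPast_subset_causalPast_of_subset_w3 [BoundarylessManifold I M] (hn : 2 ≤ n) {S T : Set M}
    (hT : T ⊆ g.causalPast τ S) : g.causalPast τ T ⊆ g.causalPast τ S := fun p hp ↦ by
  have h : p ∈ g.causalFuture τ.reverse (g.causalFuture τ.reverse S) := LorentzianMetric.causalFuture_mono hT hp
  rwa [LorentzianMetric.causalFuture_causalFuture_eq hn S] at h

end Causal

/-! ## §2 The left-hand side of the core lies below the flat late region -/

section FlatLate

variable {𝓢 : Spacetime.{0} 4} {O : Set 𝓢.carrier} {k : ℕ}

/-- Private copy of `docHole_causalPast_flatSlab` (…RecutJunctionCore, p136881, unbuilt today): under horizon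
normalisation the left-hand side of the junction core reaches arbitrarily late flat slabs. [folklore] -/
private theorem docHole_causalPast_flatSlab_w3 (d : StationaryFinalStateDecomposition 𝓢 O k) (R : Fin d.N → ℝ → ℝ)
    {τ₁ : ℝ} (hτ : d.toOver.τ₀ < τ₁) (hnorm : IsHorizonNormalised d) {p : 𝓢.carrier}
    (hp : p ∈ 𝓢.metric.causalPast 𝓢.timeOrientation (docHoleSlabs d R τ₁) ∪ docHoleTubes d R τ₁) (σ₀ : ℝ) :
    ∃ σ : ℝ, σ₀ ≤ σ ∧ p ∈ 𝓢.metric.causalPast 𝓢.timeOrientation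
      (d.toOver.flatChart '' (Minkowski.backgroundOn d.toOver.flatDomain).timeSlab σ) := by
  rcases hp with hp | hp
  · obtain ⟨q, hq, hpq⟩ := exists_mem_causalPast_singleton_w3 hp
    obtain ⟨i, hqi⟩ := mem_iUnion.1 (docHoleSlabs_subset_iUnion_w3 d R hτ hq)
    obtain ⟨x, hx, hxq⟩ := hqi
    obtain ⟨σ, hσ, hxσ⟩ := hnorm i x hx σ₀
    rw [hxq] at hxσ
    exact ⟨σ, hσ, causalPast_subset_causalPast_of_subset_w3 (WithTop.coe_le_coe.mpr le_top)
      (singleton_subset_iff.2 hxσ) hpq⟩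
  · obtain ⟨i, hpi⟩ := mem_iUnion.1 (docHoleTubes_subset_iUnion_w3 d R hτ.le hp)
    obtain ⟨x, hx, hxp⟩ := hpi
    obtain ⟨σ, hσ, hxσ⟩ := hnorm i x hx σ₀
    rw [hxp] at hxσ
    exact ⟨σ, hσ, hxσ⟩

/-- **The left-hand side of the junction core lies in `J⁻` of the flat late region after `τ₁`.** For `τ₁ > τ₀` and
horizon-normalised `d`: `J⁻(docHoleSlabs d R τ₁) ∪ docHoleTubes d R τ₁ ⊆ J⁻(Ψ₀({x⁰ > τ₁} ∩ U₀))` (a flat slab of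
time `σ ≥ τ₁ + 1` is flat-late after `τ₁`). [folklore] -/
theorem docHole_subset_causalPast_flatLate (d : StationaryFinalStateDecomposition 𝓢 O k) (R : Fin d.N → ℝ → ℝ)
    {τ₁ : ℝ} (hτ : d.toOver.τ₀ < τ₁) (hnorm : IsHorizonNormalised d) :
    𝓢.metric.causalPast 𝓢.timeOrientation (docHoleSlabs d R τ₁) ∪ docHoleTubes d R τ₁ ⊆
      𝓢.metric.causalPast 𝓢.timeOrientation
        (d.toOver.flatChart '' (Minkowski.backgroundOn d.toOver.flatDomain).lateRegion τ₁) := by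
  intro p hp
  obtain ⟨σ, hσ, hpσ⟩ := docHole_causalPast_flatSlab_w3 d R hτ hnorm hp (τ₁ + 1)
  refine LorentzianMetric.causalFuture_mono (image_mono fun z hz ↦ ?_) hpσ
  have hzσ : (Minkowski.backgroundOn d.toOver.flatDomain).time z.1 = σ := hz
  show τ₁ < (Minkowski.backgroundOn d.toOver.flatDomain).time z.1
  rw [hzσ]
  linarith

end FlatLate

/-! ## §3 The oriented core from the past-boundary property -/

/-- **Registered helper `recutJunctionCoreOriented_of_pastBoundary`**: the registered text of
`stub_recutJunctionCoreOriented` (`SigM.stub_recutJunctionCoreOriented`, the oriented `RecutJunctionCore`) with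
ONE extra hypothesis inserted after the orientation clauses — the past-boundary property (PB) of the recut
certified late region seen from the flat late region, for the transported radii `R'ᵢ τ = Rᵢ (cᵢ τ − s) − W` and
late `τ₁`:
`J⁻(Ψ₀({x⁰ > τ₁})) \ recutCertifiedLate d M a Θ R' τ₁ ⊆ J⁻(recutCertifiedSlab d M a Θ R' τ₁)`.
Given (PB) the core follows from horizon normalisation alone (`docHole_subset_causalPast_flatLate`): its left-hand
side lies in `J⁻(Ψ₀({x⁰ > τ₁}))`. So (PB) is the exact residual of the stub. [folklore] -/
theorem recutJunctionCoreOriented_of_pastBoundary : ∀ (X : Type) [TopologicalSpace X] [ChartedSpace E3 X] [IsManifold (𝓡 3) ∞ X] [T2Space X] [SecondCountableTopology X] [ConnectedSpace X] (D : InitialDataSet (𝓡 3) X) (𝒟 : VacuumCauchyDevelopment D) (O : Set 𝒟.carrier) (d : StationaryFinalStateDecomposition 𝒟.toSpacetime O 2) (M a c r₀ : Fin d.N → ℝ) (Θ : Fin d.N → E4 → E4) (R : Fin d.N → ℝ → ℝ), O = Summit.FinalStateConjecture.exteriorOf 𝒟.toCauchyDevelopment d.charted → (∀ i, Filter.Tendsto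 (fun τ ↦ 𝒟.toSpacetime.truncDeviationCk (d.background i) (d.toOver.chart i) 2 (R i τ) τ) Filter.atTop (nhds 0)) → (∀ i, Monotone (R i)) → (∀ i, Filter.Tendsto (R i) Filter.atTop Filter.atTop) → (∀ i, ∀ W s₀ : ℝ, ∀ᶠ σ in Filter.atTop, d.toOver.chart i '' ({x | (d.background i).time x.1 = σ ∧ R i (σ - s₀) - W ≤ (d.background i).radius x.1} ∩ docPart d i) ⊆ d.toOver.radiationZone) → (∀ τ₁ : ℝ, d.toOver.τ₀ < τ₁ → (O ∩ 𝒟.metric.chronologicalPast 𝒟.timeOrientation (docCharted d)) \ docCertifiedLate d R τ₁ ⊆ 𝒟.metric.causalPast 𝒟.timeOrientation (docCertifiedSlab d R τ₁)) → IsHorizonNormalised d → (∀ i, (d.hole i).horizon ⊆ Set.range (d.adapted i).toFun ∧ ChartIsAsymptoticallyCartesian (d.adapted i) ∧ InTelescope (d.hole i)) → (∀ i, IsKerrChartedWith (d.hole i) (d.adapted i) (M i) (a i) (c i) (r₀ i) (Θ i)) → (∀ i, ∀ u ∈ (Kerr.exterior (M i) (a i) : Set E4), ∀ h : Θ i u ∈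 (d.adapted i).domain, (d.hole i).timeOrientation.IsFutureDirected (mfderiv 𝓘(ℝ, E4) (𝓡 4) (d.adapted i).toFun ⟨Θ i u, h⟩ (fderiv ℝ (Θ i) u (Kerr.timeVector (M i) (a i) u)))) → (∀ (i : Fin d.N) (y : (d.background i).domain) (w : E4), d.toOver.τ₀ < (d.background i).time y.1 → (d.hole i).timeOrientation.IsFutureDirected (mfderiv 𝓘(ℝ, E4) (𝓡 4) (d.adapted i).toFun ⟨poincareInv (d.motion i).1 (d.motion i).2 y.1, ModelBackground.mem_boost_domain.1 y.2⟩ (((d.motion i).1 : E4 ≃L[ℝ] E4).symm w)) → 𝒟.metric.IsTimelike (mfderiv 𝓘(ℝ, E4) (𝓡 4) (d.toOver.chart i) y w) → 𝒟.timeOrientation.IsFutureDirected (mfderiv 𝓘(ℝ, E4) (𝓡 4) (d.toOver.chart i) y w)) → (∀ y : d.toOver.flatDomain, d.toOver.τ₀ < (y : E4) 0 → 𝒟.metric.IsTimelike (mfderiv 𝓘(ℝ, E4) (𝓡 4) d.toOver.flatChart y (E4.basisVector 0)) → 𝒟.timeOrientation.IsFutureDirected (mfderiv 𝓘(ℝ,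 E4) (𝓡 4) d.toOver.flatChart y (E4.basisVector 0))) → (∀ s W : ℝ, ∃ τP : ℝ, ∀ τ₁ : ℝ, τP < τ₁ → 𝒟.metric.causalPast 𝒟.timeOrientation (d.toOver.flatChart '' (Minkowski.backgroundOn d.toOver.flatDomain).lateRegion τ₁) \ recutCertifiedLate d M a Θ (fun i τ ↦ R i (c i * τ - s) - W) τ₁ ⊆ 𝒟.metric.causalPast 𝒟.timeOrientation (recutCertifiedSlab d M a Θ (fun i τ ↦ R i (c i * τ - s) - W) τ₁)) → ∃ s₁ : ℝ, ∀ s W : ℝ, s₁ ≤ s → s₁ ≤ W → ∃ τJ : ℝ, ∀ τ₁ : ℝ, τJ < τ₁ → (𝒟.metric.causalPast 𝒟.timeOrientation (docHoleSlabs d R τ₁) ∪ docHoleTubes d R τ₁) \ recutCertifiedLate d M a Θ (fun i τ ↦ R i (c i * τ - s) - W) τ₁ ⊆ 𝒟.metric.causalPast 𝒟.timeOrientation (recutCertifiedSlab d M a Θ (fun i τ ↦ R i (c i * τ - s) - W) τ₁) := by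
  intro X _ _ _ _ _ _ D 𝒟 O d M a c r₀ Θ R _ _ _ _ _ _ hnorm _ _ _ _ _ hPB
  refine ⟨0, fun s W _ _ ↦ ?_⟩
  obtain ⟨τP, hτP⟩ := hPB s W
  refine ⟨max τP d.toOver.τ₀, fun τ₁ hτ₁ p hp ↦ ?_⟩
  have hτP₁ : τP < τ₁ := (le_max_left _ _).trans_lt hτ₁
  have hτ₀ : d.toOver.τ₀ < τ₁ := (le_max_right _ _).trans_lt hτ₁
  exact hτP τ₁ hτP₁ ⟨docHole_subset_causalPast_flatLate d R hτ₀ hnorm hp.1, hp.2⟩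


/-! ## §4 Far hole-tube points outside the recut late region AND the radiation zone (ingredient (α) assembled) -/

section FarTubes

variable {𝓢 : Spacetime.{0} 4} {O : Set 𝓢.carrier} {k : ℕ}

/-- **The cleanest true variant of ingredient (α) at set level.** Take the slab conclusion of the companion file
(`recutJunction_holeTube_far_slab`, proposed the same day, unbuilt: taken as the hypothesis `hα`) together with
`R → ∞`, the margin-shell clause (iii) and `IsKerrChartedWith`. Then for all `s, W` there
is `τJ` such that for `τ₁ > τJ`, at the transported radii `R'ᵢ τ = Rᵢ (cᵢ τ − s) − W`, every point of the FAR old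
d.o.c. tubes after `τ₁` (chart points `ψᵢ (Pᵢ (Θᵢ x))` with `F i x`, chart time `> τ₁`, certified radius) which is
neither recut-certified late NOR IN THE RADIATION ZONE lies in `J⁻(recutCertifiedSlab … R' τ₁)`; here `F` is ANY
far-ness predicate for which the slab conclusion `hα` holds (`2H ≤ 1 − δ` by the companion file; `r ≥ r₊ + δ` once
the ergoregion is flowed by the rotating field `T + ω(r)Φ`). Bookkeeping:
with the global tilt bound `L₁` (`kerrChartedWith_global_bounds`) and the far radial control `L` of
`IsKerrChartedWith`, "not in the radiation zone" gives `Aᵢ.radius (Θᵢ x) < Rᵢ (σ − L₁ − s) − W − L` (clause (iii) at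
`s₀ = L₁ + s`, `W' = W + L`), whence Kerr–Schild time `x⁰ ≤ τ₁` (else `r(x) > R'ᵢ (x⁰)` contradicts it) and
`r(x) ≤ R'ᵢ τ₁`; then `hα`. The complementary tube points (radiation zone, flat time `≤ τ₁`; closed ergoregion)
are left to (PB). [folklore] -/
theorem recutJunction_farTubes_diff_subset : ∀ {𝓢 : Spacetime.{0} 4} {O : Set 𝓢.carrier} {k : ℕ} (d : StationaryFinalStateDecomposition 𝓢 O k) (M a c r₀ : Fin d.N → ℝ) (Θ : Fin d.N → E4 → E4) (R : Fin d.N → ℝ → ℝ), (∀ i, Monotone (R i)) → (∀ i, Filter.Tendsto (R i) Filter.atTop Filter.atTop) → (∀ i, ∀ W s₀ : ℝ, ∀ᶠ σ in Filter.atTop, d.toOver.chart i '' ({x | (d.background i).time x.1 = σ ∧ R i (σ - s₀) - W ≤ (d.background i).radius x.1} ∩ docPart d i) ⊆ d.toOver.radiationZone) → (∀ i, IsKerrChartedWith (d.hole i) (d.adapted i) (M i) (a i) (c i) (r₀ i) (Θ i)) → ∀ (F : Fin d.N → E4 → Prop), (∀ (i : Fin d.N), ∃ T : ℝ, ∀ (R'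 : Fin d.N → ℝ → ℝ) (τ₁ : ℝ), ∀ x ∈ (Kerr.exterior (M i) (a i) : Set E4), F i x → T ≤ Θ i x 0 → (d.adapted i).radius (Θ i x) ≤ R i (Θ i x 0) → x 0 ≤ τ₁ → Kerr.radius (a i) x ≤ R' i τ₁ → ∀ h₀ : ((d.motion i).1 : E4 ≃L[ℝ] E4) (Θ i x) + (d.motion i).2 ∈ (d.background i).domain, d.toOver.chart i ⟨((d.motion i).1 : E4 ≃L[ℝ] E4) (Θ i x) + (d.motion i).2, h₀⟩ ∈ 𝓢.metric.causalPast 𝓢.timeOrientation (recutCertifiedSlab d M a Θ R' τ₁)) → ∀ (s W : ℝ), ∃ τJ : ℝ, ∀ τ₁ : ℝ, τJ < τ₁ → (⋃ i, d.toOver.chart i '' {y : (d.background i).domain | τ₁ < (d.background i).time y.1 ∧ (d.background i).radius y.1 ≤ R i ((d.background i).time y.1) ∧ ∃ x ∈ (Kerr.exterior (M i) (a i) : Set E4), F i x ∧ (y : E4) = ((d.motion i).1 : E4 ≃L[ℝ] E4) (Θ i x) + (d.motion i).2}) \ (recutCertifiedLate d M a Θ (fun i τ ↦ R i (c i * τ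 - s) - W) τ₁ ∪ d.toOver.radiationZone) ⊆ 𝓢.metric.causalPast 𝓢.timeOrientation (recutCertifiedSlab d M a Θ (fun i τ ↦ R i (c i * τ - s) - W) τ₁) := by
  intro 𝓢 O k d M a c r₀ Θ R hRm hRt hRiii hW F hα s W
  -- per-hole thresholds: `T i` of `hα`, the global tilt bound `L₁ i`, the far radial control `L i`, the shell time
  -- `σ⋆ i` of clause (iii) at `(W + L i, L₁ i + s)`, and the time `τR i` after which `R' i ≥ r₊ + 1`
  choose T hT using hα
  choose L₁ hL₁0 hL₁ using fun i ↦ kerrChartedWith_global_bounds (hW i)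
  choose L hL using fun i ↦ (hW i).2.2.2.2.2.2.2.2.2.2
  choose σs hσs using fun i ↦ Filter.eventually_atTop.1 (hRiii i (W + L i) (L₁ i + s))
  choose ρR hρR using fun i ↦ Filter.eventually_atTop.1 ((hRt i).eventually_ge_atTop (W + (Kerr.rPlus (M i) (a i) + 1)))
  have hc : ∀ i, 0 < c i := fun i ↦ (hW i).2.1
  obtain ⟨τJ, hτJ⟩ := Finite.exists_le fun i ↦ max (max (T i) (σs i)) ((ρR i + s) / c i)
  refine ⟨τJ, fun τ₁ hτ₁ p hp ↦ ?_⟩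
  obtain ⟨hp, hpΩ⟩ := hp
  obtain ⟨i, hpi⟩ := mem_iUnion.1 hp
  obtain ⟨y, ⟨hyt, hyR, x, hx, hH, hy1⟩, rfl⟩ := hpi
  -- thresholds at hole `i`
  have hTi : T i < τ₁ := ((le_max_left _ _).trans ((le_max_left _ _).trans (hτJ i))).trans_lt hτ₁
  have hσi : σs i < τ₁ := ((le_max_right _ _).trans ((le_max_left _ _).trans (hτJ i))).trans_lt hτ₁
  have hρi : (ρR i + s) / c i < τ₁ := ((le_max_right _ _).trans (hτJ i)).trans_lt hτ₁
  have hR'big : ∀ t : ℝ, τ₁ ≤ t → Kerr.rPlus (M i) (a i) + 1 ≤ R i (c i * t - s) - W := by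
    intro t ht
    have h1 : ρR i + s < c i * t := by
      have h2 := (div_lt_iff₀ (hc i)).1 (hρi.trans_le ht); linarith
    have h3 := hρR i (c i * t - s) (by linarith)
    linarith
  -- the clauses of `IsKerrChartedWith` at hole `i`
  have h10 := (hW i).2.2.2.2.2.2.2.2.2.1
  -- the data of the point: chart time `σ = (Θ x)⁰`, adapted radius `A.radius (Θ x)`
  have hPy : poincareInv (d.motion i).1 (d.motion i).2 (y : E4) = Θ i x := by rw [hy1, poincareInv_apply_add]
  have hσ : (d.background i).time y.1 = Θ i x 0 := by
    show (poincareInv (d.motion i).1 (d.motion i).2 (y : E4)) 0 = _; rw [hPy]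
  have hrad : (d.background i).radius y.1 = (d.adapted i).radius (Θ i x) := by
    show (d.adapted i).radius (poincareInv (d.motion i).1 (d.motion i).2 (y : E4)) = _; rw [hPy]
  rw [hσ] at hyt hyR
  rw [hrad] at hyR
  have htilt := (abs_le.1 ((hL₁ i) x hx).1).2
  -- (A) the point is not recut-certified late: its Kerr–Schild data are not in the recut tube
  have hA : ¬ (τ₁ < x 0 ∧ Kerr.radius (a i) x ≤ R i (c i * x 0 - s) - W) := by
    rintro ⟨h1, h2⟩
    refine hpΩ (Or.inl (Or.inr (mem_iUnion.2 ⟨i, mem_image_of_mem _ ?_⟩)))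
    have hPz : poincareInv (d.motion i).1 (d.motion i).2 (((d.motion i).1 : E4 ≃L[ℝ] E4) x + (d.motion i).2) = x :=
      poincareInv_apply_add _ _ _
    have hz : ((d.motion i).1 : E4 ≃L[ℝ] E4) x + (d.motion i).2 ∈ ((recutBackground d M a i).domain : Set E4) := by
      show poincareInv (d.motion i).1 (d.motion i).2 _ ∈ (Kerr.exterior (M i) (a i) : Set E4)
      rw [hPz]; exact hx
    refine ⟨_, ⟨⟨_, hz⟩, ⟨?_, ?_⟩, rfl⟩, ?_⟩
    · show τ₁ < (poincareInv (d.motion i).1 (d.motion i).2 (((d.motion i).1 : E4 ≃L[ℝ] E4) x + (d.motion i).2)) 0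
      rw [hPz]; exact h1
    · show Kerr.radius (a i) (poincareInv (d.motion i).1 (d.motion i).2 (((d.motion i).1 : E4 ≃L[ℝ] E4) x + (d.motion i).2)) ≤
        R i (c i * (poincareInv (d.motion i).1 (d.motion i).2 (((d.motion i).1 : E4 ≃L[ℝ] E4) x + (d.motion i).2)) 0 - s) - W
      rw [hPz]; exact h2
    · show ((d.motion i).1 : E4 ≃L[ℝ] E4) (Θ i (poincareInv (d.motion i).1 (d.motion i).2
        (((d.motion i).1 : E4 ≃L[ℝ] E4) x + (d.motion i).2))) + (d.motion i).2 = (y : E4)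
      rw [hPz, hy1]
  -- (B) the point is not in the radiation zone: its adapted radius is below the margin shell (clause (iii))
  have hB : (d.adapted i).radius (Θ i x) < R i (Θ i x 0 - (L₁ i + s)) - (W + L i) := by
    by_contra hge
    push Not at hge
    refine hpΩ (Or.inr (hσs i (Θ i x 0) (hσi.le.trans hyt.le) (mem_image_of_mem _ ⟨⟨hσ, ?_⟩, ?_⟩)))
    · show R i (Θ i x 0 - (L₁ i + s)) - (W + L i) ≤ (d.background i).radius y.1
      rw [hrad]; exact hge
    · show ∃ h : poincareInv (d.motion i).1 (d.motion i).2 y.1 ∈ (d.adapted i).domain,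
        (d.adapted i).toFun ⟨_, h⟩ ∈ (d.hole i).doc
      rw [hPy]
      have hmem : Θ i x ∈ {u : E4 | ∃ h : u ∈ (d.adapted i).domain, (d.adapted i).toFun ⟨u, h⟩ ∈ (d.hole i).doc} :=
        h10 ▸ mem_image_of_mem _ hx
      exact hmem
  -- hence Kerr–Schild time `x⁰ ≤ τ₁` …
  have ht : x 0 ≤ τ₁ := by
    by_contra hlt
    push Not at hlt
    have hρ : R i (c i * x 0 - s) - W < Kerr.radius (a i) x := by
      by_contra hle
      push Not at hle
      exact hA ⟨hlt, hle⟩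
    by_cases hfar : Kerr.rPlus (M i) (a i) + 1 ≤ Kerr.radius (a i) x
    · have h3 := (abs_le.1 (hL i x hx hfar).2.1).1
      have h4 : R i (Θ i x 0 - (L₁ i + s)) ≤ R i (c i * x 0 - s) := hRm i (by linarith)
      linarith
    · push Not at hfar
      linarith [hR'big (x 0) hlt.le]
  -- … and Kerr–Schild radius `r(x) ≤ R' i τ₁`
  have hρ : Kerr.radius (a i) x ≤ R i (c i * τ₁ - s) - W := by
    by_cases hfar : Kerr.rPlus (M i) (a i) + 1 ≤ Kerr.radius (a i) x
    · have h3 := (abs_le.1 (hL i x hx hfar).2.1).1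
      have h5 : c i * x 0 ≤ c i * τ₁ := mul_le_mul_of_nonneg_left ht (hc i).le
      have h4 : R i (Θ i x 0 - (L₁ i + s)) ≤ R i (c i * τ₁ - s) := hRm i (by linarith)
      linarith
    · push Not at hfar
      linarith [hR'big τ₁ le_rfl]
  -- conclude by ingredient (α)
  have h₀ : ((d.motion i).1 : E4 ≃L[ℝ] E4) (Θ i x) + (d.motion i).2 ∈ (d.background i).domain := hy1 ▸ y.2
  have hy : y = ⟨((d.motion i).1 : E4 ≃L[ℝ] E4) (Θ i x) + (d.motion i).2, h₀⟩ := Subtype.ext hy1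
  rw [hy]
  exact hT i (fun j τ ↦ R j (c j * τ - s) - W) τ₁ x hx hH (hTi.le.trans hyt.le) hyR ht hρ h₀

end FarTubes
end Summit.FinalStateConjecture.FinalStateConjecture.Theorems.SymplecticDualOfTheBomb

end
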